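import Summits.AtomisticToContinuum.BoseEinsteinCondensation.Theorems.InfraredMinimumUncertainty.Negative.CommutatorToolkit

/-!
# Negative lemmas for crux `InfraredMinimumUncertainty` (stmt-AtomisticToContinuum-11784) — X:
# the commutator amplitude of the free density wave and its second moment

Supports (does not close) stmt-AtomisticToContinuum-11784.  Importable form of §H (part 2 of 6) of the
cdisprove seat's standing file `Cruxes/InfraredMinimumUncertainty/Disproof.lean` (generation 2).

For the free density wave `Ψ = (c(1+2ε cos θ_{e₀}))^{⊗N}` of `FreeDensityWave.lean` at its own mode:
* `fderiv_waveFactorC_waveVec`, `betaFactor` (`β = e_{e₀}·c(φ_ε + 4iε sin θ)`), `commutatorAmp_waveFun`: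
  **`W_{e₀} = [−Δ, Z_{e₀}]Ψ = ‖k‖² ∑ⱼ β(xⱼ) ∏_{i≠j} φ(xᵢ)`**;
* `betaFactor_mul_waveFactorC` (plane-wave expansion), **`integral_cell_betaFactor_mul_waveFactorC`:
  `∫_cell β φ = 0` — NO Bragg component in `W`** (the one-body identity `∫ e^{iθ}(f² − i∂_θ f²) dθ = 0`,
  i.e. `⟨Ψ,[−Δ,Z]Ψ⟩ = 0` slot by slot), `integral_cell_norm_sq_betaFactor` (`∫_cell |β|² = (1+10ε²)/(1+2ε²)`);
* **`secondMoment_waveFun`: `m₂ = ‖W‖² = N‖k‖⁴(1+10ε²)/(1+2ε²)` EXACTLY** — `O(N‖k‖⁴)` although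
  `S_{e₀} ≍ ε²N` is a Bragg peak.
-/

noncomputable section

open MeasureTheory Filter Set
open scoped ENNReal NNReal Topology ComplexConjugate BigOperators

namespace Summit.AtomisticToContinuum.BoseEinsteinCondensation.Theorems.InfraredMinimumUncertainty.Negative

open Literature.MathematicalPhysics.QuantumManyBody.BoseGas
open Summit.AtomisticToContinuum.BoseEinsteinCondensation.Theses.BECConjugateDomination
open Summit.AtomisticToContinuum.BoseEinsteinCondensation.Cruxes.InfraredMinimumUncertainty.FisherGaussianDensityMode
open Summit.AtomisticToContinuum.BoseEinsteinCondensation.Theorems.GaussianDominationCan.Negative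
  (prodFun contDiff_prodFun fderiv_prodFun integral_cellN_prod)
open Summit.AtomisticToContinuum.BoseEinsteinCondensation.Theorems.StaticResponseBound.Negative
  (arg re_cellWave integral_norm_sq_eq_one phiMode argCLM argCLM_apply integral_cell_trig_combo
    phiMode_sq integral_cell_phiMode_sq arg_intSMul isRepulsiveFiniteRange_zero)
open Summit.AtomisticToContinuum.BoseEinsteinCondensation.Theorems.CorrectorClosure.Negative
  (e0 e0_ne_zero sideLength_succ_pos)

/-! ### The commutator amplitude of the free density wave -/

section WaveCommutator

variable {L : ℝ} {ε : ℝ} {n : ℕ}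

/-- The derivative of the one-body factor along `k = waveVec L e₀`:
`∂_k φ_ℂ(x) = c · (−2ε sin θ(x)) · (2π/L)²` (`θ_{e₀}(k) = ‖k‖²`). [folklore] -/
theorem fderiv_waveFactorC_waveVec (L ε : ℝ) (x : Space) :
    fderiv ℝ (waveFactorC L ε) x (waveVec L e0) =
      ((cnorm L ε * (2 * ε * -Real.sin (arg L e0 x)) * (2 * Real.pi / L) ^ 2 : ℝ) : ℂ) := by
  rw [(hasFDerivAt_waveFactorC L ε x).fderiv, ContinuousLinearMap.comp_apply,
    FunLike.coe_smul, Pi.smul_apply, argCLM_apply, arg_waveVec_e0, smul_eq_mul]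
  rfl

/-- The one-body factor carried by the differentiated slot of the commutator amplitude of the
density wave: `β(x) = e_{e₀}(x) · c (φ_ε(x) + 4iε sin θ(x))`. -/
def betaFactor (L ε : ℝ) (x : Space) : ℂ :=
  cellWave L e0 x *
    (waveFactorC L ε x + ((4 * ε * cnorm L ε : ℝ) : ℂ) * ((Real.sin (arg L e0 x) : ℂ) * Complex.I))

/-- `β` is continuous. [folklore] -/
theorem continuous_betaFactor (L ε : ℝ) : Continuous (betaFactor L ε) := by
  unfold betaFactor
  refine (continuous_cellWave L e0).mul ((continuous_waveFactorC L ε).add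
    (continuous_const.mul ((Complex.continuous_ofReal.comp ?_).mul continuous_const)))
  exact Real.continuous_sin.comp (Summit.AtomisticToContinuum.BoseEinsteinCondensation.Theorems.StaticResponseBound.Negative.continuous_arg L e0)

/-- A one-slot insertion of continuous factors is continuous on configuration space. [folklore] -/
theorem continuous_slotFun {N : ℕ} {f a : Space → ℂ} (hf : Continuous f) (ha : Continuous a)
    (j : Fin N) : Continuous fun X : Config N => slotFun f a j X :=
  (ha.comp (continuous_apply j)).mul
    (continuous_finsetProd _ fun i _ => hf.comp (continuous_apply i))

/-- **The commutator amplitude of the free density wave at its own mode**: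
`W_{e₀}(X) = ∑ⱼ e(xⱼ)(‖k‖²Ψ − 2i∂_{xⱼ·k}Ψ) = ‖k‖² ∑ⱼ β(xⱼ) ∏_{i≠j} φ_ℂ(xᵢ)`. [folklore] -/
theorem commutatorAmp_waveFun (L ε : ℝ) (X : Config (n + 1)) :
    commutatorAmp (n + 1) L (waveFun n L ε) e0 X =
      (((2 * Real.pi / L) ^ 2 : ℝ) : ℂ) * ∑ j, slotFun (waveFactorC L ε) (betaFactor L ε) j X := by
  unfold commutatorAmp
  rw [norm_waveVec_e0_sq, Finset.mul_sum]
  refine Finset.sum_congr rfl fun j _ => ?_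
  have hd : ∀ _i : Fin (n + 1), Differentiable ℝ (waveFactorC L ε) := fun _ =>
    (contDiff_waveFactorC L ε).differentiable one_ne_zero
  have hprod : waveFun n L ε X =
      waveFactorC L ε (X j) * ∏ i ∈ Finset.univ.erase j, waveFactorC L ε (X i) :=
    (Finset.mul_prod_erase Finset.univ (fun i => waveFactorC L ε (X i)) (Finset.mem_univ j)).symm
  rw [show waveFun n L ε = prodFun (fun _ : Fin (n + 1) => waveFactorC L ε) from rfl,
    fderiv_prodFun hd X j,
    show prodFun (fun _ : Fin (n + 1) => waveFactorC L ε) X = waveFun n L ε X from rfl, hprod,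
    fderiv_waveFactorC_waveVec]
  unfold slotFun betaFactor waveFactorC
  push_cast
  ring

/-- `φ_ℂ` is real: `conj φ_ℂ = φ_ℂ`. [folklore] -/
theorem conj_waveFactorC (L ε : ℝ) (x : Space) : conj (waveFactorC L ε x) = waveFactorC L ε x := by
  rw [waveFactorC, Complex.conj_ofReal]

/-- `∫_cell φ_ℂ φ_ℂ = 1`. [folklore] -/
theorem integral_cell_waveFactorC_mul_self (hL : 0 < L) (ε : ℝ) :
    ∫ x in cell L, waveFactorC L ε x * waveFactorC L ε x = 1 := by
  unfold waveFactorC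
  simp_rw [← Complex.ofReal_mul, ← sq]
  rw [integral_complex_ofReal, integral_cell_waveFactor_sq hL ε, Complex.ofReal_one]

/-- `conj` of a slot insertion into the REAL product `φ_ℂ^{⊗N}`. [folklore] -/
theorem conj_slotFun_waveFactorC (L ε : ℝ) (a : Space → ℂ) (j : Fin (n + 1)) (X : Config (n + 1)) :
    conj (slotFun (waveFactorC L ε) a j X) =
      slotFun (waveFactorC L ε) (fun x => conj (a x)) j X := by
  unfold slotFun
  rw [map_mul, map_prod]
  simp_rw [conj_waveFactorC]

/-- The real product state as a (trivial) slot insertion: `Ψ(X) = φ_ℂ(xⱼ) ∏_{i≠j} φ_ℂ(xᵢ)`. [folklore] -/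
theorem waveFun_eq_slotFun (L ε : ℝ) (j : Fin (n + 1)) (X : Config (n + 1)) :
    waveFun n L ε X = slotFun (waveFactorC L ε) (waveFactorC L ε) j X :=
  (Finset.mul_prod_erase Finset.univ (fun i => waveFactorC L ε (X i)) (Finset.mem_univ j)).symm

/-- `conj Ψ = Ψ` for the real product state. [folklore] -/
theorem conj_waveFun (L ε : ℝ) (X : Config (n + 1)) : conj (waveFun n L ε X) = waveFun n L ε X := by
  show conj (∏ i, waveFactorC L ε (X i)) = ∏ i, waveFactorC L ε (X i)
  rw [map_prod]
  simp_rw [conj_waveFactorC]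

/-- **Pointwise plane-wave expansion of `β φ_ℂ`**:
`β φ_ℂ = c² ((1+2ε²) e + 4ε e² + 3ε² e³ − ε² ē)` (from `e ē = 1`, `2cos θ = e + ē`,
`2i sin θ = e − ē`). [folklore] -/
theorem betaFactor_mul_waveFactorC (L ε : ℝ) (x : Space) :
    betaFactor L ε x * waveFactorC L ε x =
      ((cnorm L ε ^ 2 : ℝ) : ℂ) * ((1 + 2 * ε ^ 2) * cellWave L e0 x
        + 4 * ε * (cellWave L e0 x * cellWave L e0 x)
        + 3 * ε ^ 2 * (cellWave L e0 x * cellWave L e0 x * cellWave L e0 x)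
        - ε ^ 2 * conj (cellWave L e0 x)) := by
  have h1 := cellWave_mul_conj L e0 x
  have hc := two_cos_arg_eq L e0 x
  have hs := two_sin_arg_mul_I_eq L e0 x
  have hc' : Complex.cos ((arg L e0 x : ℝ) : ℂ) = (cellWave L e0 x + conj (cellWave L e0 x)) / 2 := by
    rw [← Complex.ofReal_cos, ← hc]; ring
  have hs' : (Real.sin (arg L e0 x) : ℂ) * Complex.I =
      (cellWave L e0 x - conj (cellWave L e0 x)) / 2 := by
    rw [← hs]; ring
  unfold betaFactor
  rw [hs']
  unfold waveFactorC waveFactor phiMode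
  push_cast
  rw [hc']
  linear_combination ((cnorm L ε : ℂ)) ^ 2 * (2 * (ε : ℂ) ^ 2 * cellWave L e0 x
    - (ε : ℂ) ^ 2 * conj (cellWave L e0 x)) * h1

/-- **No Bragg component in the commutator amplitude**: `∫_cell β φ_ℂ = 0`. [folklore] -/
theorem integral_cell_betaFactor_mul_waveFactorC (hL : 0 < L) (ε : ℝ) :
    ∫ x in cell L, betaFactor L ε x * waveFactorC L ε x = 0 := by
  simp_rw [betaFactor_mul_waveFactorC]
  rw [integral_const_mul]
  have ie : Integrable (cellWave L e0) (volume.restrict (cell L)) :=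
    integrableOn_cell (continuous_cellWave L e0)
  have ie2 : Integrable (fun x => cellWave L e0 x * cellWave L e0 x) (volume.restrict (cell L)) :=
    integrableOn_cell ((continuous_cellWave L e0).mul (continuous_cellWave L e0))
  have ie3 : Integrable (fun x => cellWave L e0 x * cellWave L e0 x * cellWave L e0 x)
      (volume.restrict (cell L)) :=
    integrableOn_cell (((continuous_cellWave L e0).mul (continuous_cellWave L e0)).mul
      (continuous_cellWave L e0))
  have iec : Integrable (fun x => conj (cellWave L e0 x)) (volume.restrict (cell L)) :=
    integrableOn_cell (Complex.continuous_conj.comp (continuous_cellWave L e0))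
  have i1 : Integrable (fun x => (1 + 2 * (ε : ℂ) ^ 2) * cellWave L e0 x) (volume.restrict (cell L)) :=
    ie.const_mul _
  have i2 : Integrable (fun x => 4 * (ε : ℂ) * (cellWave L e0 x * cellWave L e0 x))
      (volume.restrict (cell L)) := ie2.const_mul _
  have i3 : Integrable (fun x => 3 * (ε : ℂ) ^ 2 * (cellWave L e0 x * cellWave L e0 x * cellWave L e0 x))
      (volume.restrict (cell L)) := ie3.const_mul _
  have i4 : Integrable (fun x => (ε : ℂ) ^ 2 * conj (cellWave L e0 x)) (volume.restrict (cell L)) :=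
    iec.const_mul _
  have i12 : Integrable (fun x => (1 + 2 * (ε : ℂ) ^ 2) * cellWave L e0 x
      + 4 * (ε : ℂ) * (cellWave L e0 x * cellWave L e0 x)) (volume.restrict (cell L)) := i1.add i2
  have i123 : Integrable (fun x => (1 + 2 * (ε : ℂ) ^ 2) * cellWave L e0 x
      + 4 * (ε : ℂ) * (cellWave L e0 x * cellWave L e0 x)
      + 3 * (ε : ℂ) ^ 2 * (cellWave L e0 x * cellWave L e0 x * cellWave L e0 x))
      (volume.restrict (cell L)) := i12.add i3
  rw [integral_sub i123 i4, integral_add i12 i3, integral_add i1 i2,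
    integral_const_mul, integral_const_mul, integral_const_mul, integral_const_mul,
    integral_cell_cellWave_eq_zero hL e0_ne_zero, integral_cell_cellWave_sq hL e0_ne_zero,
    integral_cell_cellWave_cube hL e0_ne_zero, integral_cell_conj_cellWave hL e0_ne_zero]
  ring

/-- `|β|² = c² (φ_ε² + 16ε² sin²θ)`. [folklore] -/
theorem norm_sq_betaFactor (L ε : ℝ) (x : Space) :
    ‖betaFactor L ε x‖ ^ 2 =
      cnorm L ε ^ 2 * (phiMode L e0 ε x ^ 2 + 16 * ε ^ 2 * Real.sin (arg L e0 x) ^ 2) := by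
  unfold betaFactor
  rw [norm_mul, norm_cellWave, one_mul, waveFactorC, waveFactor,
    show ((cnorm L ε * phiMode L e0 ε x : ℝ) : ℂ) +
        ((4 * ε * cnorm L ε : ℝ) : ℂ) * ((Real.sin (arg L e0 x) : ℂ) * Complex.I) =
      ((cnorm L ε * phiMode L e0 ε x : ℝ) : ℂ) +
        ((4 * ε * cnorm L ε * Real.sin (arg L e0 x) : ℝ) : ℂ) * Complex.I by push_cast; ring,
    Complex.sq_norm, Complex.normSq_add_mul_I]
  ring

/-- **`∫_cell |β|² = (1 + 10ε²)/(1 + 2ε²)`**. [folklore] -/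
theorem integral_cell_norm_sq_betaFactor (hL : 0 < L) (ε : ℝ) :
    ∫ x in cell L, ‖betaFactor L ε x‖ ^ 2 = (1 + 10 * ε ^ 2) / (1 + 2 * ε ^ 2) := by
  simp_rw [norm_sq_betaFactor]
  have hpt : ∀ x, cnorm L ε ^ 2 * (phiMode L e0 ε x ^ 2 + 16 * ε ^ 2 * Real.sin (arg L e0 x) ^ 2) =
      cnorm L ε ^ 2 * ((1 + 10 * ε ^ 2) + (4 * ε) * Real.cos (arg L e0 x)
        + (-6 * ε ^ 2) * Real.cos (arg L ((2 : ℤ) • e0) x)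
        + 0 * Real.cos (arg L ((3 : ℤ) • e0) x)) := by
    intro x
    rw [phiMode_sq, Real.sin_sq, Real.cos_sq (arg L e0 x)]
    simp only [arg_intSMul]
    push_cast
    ring
  simp_rw [hpt]
  rw [integral_const_mul, integral_cell_trig_combo hL e0_ne_zero,
    show cnorm L ε ^ 2 * ((1 + 10 * ε ^ 2) * L ^ 3) = (1 + 10 * ε ^ 2) * (cnorm L ε ^ 2 * L ^ 3) by ring,
    cnorm_sq_mul_cube hL, div_eq_mul_inv]

/-- `∫_cell conj(β) β = (1 + 10ε²)/(1 + 2ε²)` (complex form). [folklore] -/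
theorem integral_cell_conj_betaFactor_mul (hL : 0 < L) (ε : ℝ) :
    ∫ x in cell L, conj (betaFactor L ε x) * betaFactor L ε x =
      (((1 + 10 * ε ^ 2) / (1 + 2 * ε ^ 2) : ℝ) : ℂ) := by
  simp_rw [← Complex.normSq_eq_conj_mul_self, Complex.normSq_eq_norm_sq]
  rw [integral_complex_ofReal, integral_cell_norm_sq_betaFactor hL]

/-- **The second moment of the density wave**:
`m₂ = ∫_{cell^N} |W_{e₀}|² = N ‖k‖⁴ (1 + 10ε²)/(1 + 2ε²)` — only the DIAGONAL slot pairs survive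
(`∫_cell β φ_ℂ = 0`). [folklore] -/
theorem secondMoment_waveFun (hL : 0 < L) (ε : ℝ) :
    secondMoment (n + 1) L (waveFun n L ε) e0 =
      ((n : ℝ) + 1) * ((2 * Real.pi / L) ^ 2) ^ 2 * ((1 + 10 * ε ^ 2) / (1 + 2 * ε ^ 2)) := by
  unfold secondMoment
  simp_rw [commutatorAmp_waveFun, norm_mul, mul_pow, Complex.norm_real, Real.norm_eq_abs, sq_abs]
  rw [integral_const_mul]
  have hf1 : ∫ x in cell L, waveFactorC L ε x * waveFactorC L ε x = 1 :=
    integral_cell_waveFactorC_mul_self hL ε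
  have hβf : ∫ x in cell L, betaFactor L ε x * waveFactorC L ε x = 0 :=
    integral_cell_betaFactor_mul_waveFactorC hL ε
  have hcont : ∀ j : Fin (n + 1), Continuous fun X : Config (n + 1) =>
      slotFun (waveFactorC L ε) (betaFactor L ε) j X := fun j =>
    continuous_slotFun (continuous_waveFactorC L ε) (continuous_betaFactor L ε) j
  have key : ∫ X in cellN (n + 1) L, ‖∑ j, slotFun (waveFactorC L ε) (betaFactor L ε) j X‖ ^ 2 =
      ((n : ℝ) + 1) * ((1 + 10 * ε ^ 2) / (1 + 2 * ε ^ 2)) := by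
    apply Complex.ofReal_injective
    rw [← integral_complex_ofReal]
    simp_rw [← Complex.normSq_eq_norm_sq]
    simp_rw [Complex.normSq_eq_conj_mul_self]
    simp_rw [map_sum, Finset.sum_mul_sum, conj_slotFun_waveFactorC]
    have hint : ∀ l j : Fin (n + 1), Integrable (fun X : Config (n + 1) =>
        slotFun (waveFactorC L ε) (fun x => conj (betaFactor L ε x)) l X *
          slotFun (waveFactorC L ε) (betaFactor L ε) j X) (volume.restrict (cellN (n + 1) L)) :=
      fun l j => integrableOn_cellN ((continuous_slotFun (continuous_waveFactorC L ε)
        (Complex.continuous_conj.comp (continuous_betaFactor L ε)) l).mul (hcont j)) L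
    rw [integral_finsetSum _ fun l _ => integrable_finsetSum _ fun j _ => hint l j]
    rw [Finset.sum_congr rfl fun l _ => integral_finsetSum _ fun j _ => hint l j]
    simp_rw [integral_slotFun_mul_slotFun hf1]
    have hconjβf : ∫ x in cell L, conj (betaFactor L ε x) * waveFactorC L ε x = 0 := by
      have : ∀ x, conj (betaFactor L ε x) * waveFactorC L ε x =
          conj (betaFactor L ε x * waveFactorC L ε x) := fun x => by
        rw [map_mul, conj_waveFactorC]
      simp_rw [this]
      rw [integral_conj, hβf, map_zero]
    simp only [hconjβf, hβf, mul_zero, Finset.sum_ite_eq, Finset.mem_univ, if_true]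
    rw [integral_cell_conj_betaFactor_mul hL, Finset.sum_const, Finset.card_univ, Fintype.card_fin,
      nsmul_eq_mul]
    push_cast
    ring
  rw [key]
  ring

end WaveCommutator

end Summit.AtomisticToContinuum.BoseEinsteinCondensation.Theorems.InfraredMinimumUncertainty.Negative

end
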